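import Summits.QuantumFields.YangMills.Theorems.BalabanUVNodesN15KingModelGaussianMoments
import Literature.MathematicalPhysics.QuantumFieldTheory.CurvatureGaussianField
import Mathlib.Probability.Moments.ComplexMGF

/-!
# BalabanUVNodes ∕ N15 — THE KING-MODEL RUNG (PART Ϝ-u): THE DENSITY-DEFINED LAW `ρ_A dx` IS A GAUSSIAN MEASURE IN MATHLIB's SENSE AND IS THE
# TREE's GAUSSIAN FIELD OF KERNEL `A⁻¹` — `(ρ_A dx)∘⟨J,·⟩⁻¹ = 𝒩(0, ⟨J,A⁻¹J⟩)` (MGF ⇒ complex MGF ⇒ law), `IsGaussian (ρ_A dx)`,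
# `ρ_A dx = gaussianFieldOfKernel (A⁻¹)`; KING: THE LAW OF THE BLOCK AVERAGES OF THE FINE FREE FIELD IS `gaussianFieldOfKernel S₂^{(K)}`
# (Track A, DAG node N15 = NE2; FAN-OUT v1.1 §N15 s3 «KING-MODEL RUNG»; uses parts Τ-a, Ϝ-d, Ϝ-q, Ϝ-r, Ϝ-s and `Literature…CurvatureGaussianField`; count-neutral)

HONEST FRAMING.  Count-neutral (cell `pub-ymgap`, seat `pub-ymgap-dag-n15-e` g33; `--supports stmt-QuantumFields-27366 --as helper` = K3⁸
`SpineGivenEndpointR13SepCoPHV`).  This file IDENTIFIES the two Gaussian worlds of the tree: the DENSITY-defined centred law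
`ρ_A(x)dx = e^{−½⟨x,Ax⟩}dx∕𝒩(A)` of parts Τ∕Ϡ∕Ϝ ([King1986] (C. King, Commun. Math. Phys. **102** (1986) 649–677) (2.6) p.652 — the shape of every
measure of the paper; `A` symmetric coercive on `ℝ^ι`, `ι` finite) and the KOLMOGOROV-built `gaussianFieldOfKernel K` of
`Literature.MathematicalPhysics.QuantumFieldTheory.CurvatureGaussianField` (Mathlib's `multivariateGaussian` marginals).  Route (folklore, all Mathlib):
part Τ-a's real MGF `t ↦ e^{½t²Q}`, `Q = ⟨J,A⁻¹J⟩`, of the linear functional `⟨J,·⟩` equals that of `gaussianReal 0 Q`; MGFs finite on all of `ℝ` ⇒ the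
complex MGFs agree on `ℂ` (`ProbabilityTheory.eqOn_complexMGF_of_mgf`, analytic continuation) ⇒ the laws agree (`Measure.ext_of_complexMGF_eq`); every
continuous linear functional on `ℝ^ι` is some `⟨J,·⟩` ⇒ `IsGaussian` (`isGaussian_of_map_eq_gaussianReal`); the coordinate process is then a centred Gaussian
process with covariance `A⁻¹` (part Ϝ-s) ⇒ `ρ_A dx = gaussianFieldOfKernel (A⁻¹)` by the tree's uniqueness theorem
`eq_gaussianFieldOfKernel_of_isGaussianProcess` (Kallenberg Lemma 13.1).  KING APPLICATION (`A = 0`, `g = 0` free covariance model; unit torus `𝕋_M`, fine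
torus `T_{1∕N}`, `N = L^K`): ★★★ the law `ρ_{P_K}dφ`, `P_K = (S₂^{(K)})⁻¹`, of the block averages of the fine free field (part Ϝ-r) IS
`gaussianFieldOfKernel S₂^{(K)}` and is `IsGaussian`; the smeared block field `⟨J,φ⟩` is `gaussianReal 0 ⟨J,S₂^{(K)}J⟩`; the `K = ∞` twins with `S₂^{(∞)}`.
Consequently every theorem of the tree ∕ Mathlib about Gaussian fields (`B3WTFreeMeasure`'s Wick calculus, Fernique, …) applies to King's block-field
laws.  Nothing Bałaban ∕ continuum-Yang–Mills ∕ `ℝ⁴` ∕ OS ∕ mass-gap ∕ Clay; N15 is booked through n15-a's knit, untouched here.  0 `sorry`; ONE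
plumbing def (`gaussLaw A` = `ρ_A dx` as a `Measure`); standard axioms.

WHAT THIS FILE PROVES (kernel).  §1 `gaussLaw`, `integral_gaussLaw`, `integral_gaussLaw_real`, `integrable_gaussLaw_iff`, `isProbabilityMeasure_gaussLaw`;
§2 `mgf_dot_gaussLaw`, `integrableExpSet_dot_gaussLaw`, `complexMGF_dot_gaussLaw`, ★★★ **`map_dot_gaussLaw`** (`= gaussianReal 0 ⟨J,A⁻¹J⟩`); §3 `dual_apply_eq_dot`,
★★★ **`isGaussian_gaussLaw`**, `integral_eval_gaussLaw`, `covariance_eval_gaussLaw`, `isGaussianProcess_eval_gaussLaw`, `isPosSemidefKernel_inv`,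
★★★ **`gaussLaw_eq_gaussianFieldOfKernel`**; §4 KING: ★★★ **`fineBlockLaw_eq_gaussianFieldOfKernel`**, ★★★ `fineBlockLawLim_eq_gaussianFieldOfKernel`,
★★ `isGaussian_fineBlockLaw(_Lim)`, ★★ `map_dot_fineBlockLaw` (`⟨J,φ⟩ ∼ 𝒩(0, ⟨J,S₂^{(K)}J⟩)`), `map_eval_fineBlockLaw` (`φ(x) ∼ 𝒩(0, S₂^{(K)}(x,x))`).
-/

noncomputable section

open scoped BigOperators NNReal ENNReal
open Finset Matrix Filter Topology MeasureTheory ProbabilityTheory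

namespace Summit.QuantumFields.YangMills.BalabanUVNodes.N15KingModelRung.FreeField

open Literature.MathematicalPhysics.QuantumFieldTheory (IsPosSemidefKernel covGram gaussianFieldOfKernel
  eq_gaussianFieldOfKernel_of_isGaussianProcess)
open Literature.MathematicalPhysics.QuantumFieldTheory.Balaban1983to89.QGQInverse (Coercive isUnit_of_coercive)

variable {ι : Type*} [Fintype ι] [DecidableEq ι]

/-! ## §1 The law `ρ_A dx` as a measure on `ℝ^ι` -/

section Law

variable {A : Matrix ι ι ℝ} {δ : ℝ}

/-- The centred Gaussian LAW with precision `A`: the measure `ρ_A(x)dx` on `ℝ^ι` (Lebesgue measure with density part Ϝ-q's `gaussDensity A`).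
[cite: King1986, (2.6) p.652] -/
def gaussLaw (A : Matrix ι ι ℝ) : Measure (ι → ℝ) := volume.withDensity fun x => ((gaussDensity A x).toNNReal : ℝ≥0∞)

omit [DecidableEq ι] in
/-- The density is measurable (as an `ℝ≥0`-valued function). [folklore] -/
theorem measurable_toNNReal_gaussDensity (A : Matrix ι ι ℝ) : Measurable fun x : ι → ℝ => (gaussDensity A x).toNNReal :=
  (continuous_gaussDensity A).measurable.real_toNNReal

omit [DecidableEq ι] in
/-- Integration against the law is integration against the density: `∫ g d(ρ_A dx) = ∫ ρ_A(x)•g(x) dx`. [folklore] -/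
theorem integral_gaussLaw {E : Type*} [NormedAddCommGroup E] [NormedSpace ℝ E] (hδ : 0 < δ) (hA : Coercive A δ) (g : (ι → ℝ) → E) :
    ∫ x, g x ∂gaussLaw A = ∫ x, gaussDensity A x • g x := by
  unfold gaussLaw
  rw [integral_withDensity_eq_integral_smul (measurable_toNNReal_gaussDensity A)]
  refine integral_congr_ae (Eventually.of_forall fun x => ?_)
  have h0 : 0 ≤ gaussDensity A x := gaussDensity_nonneg hδ hA x
  dsimp only
  rw [NNReal.smul_def, Real.coe_toNNReal _ h0]

omit [DecidableEq ι] in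
/-- Real-valued observables: `∫ g d(ρ_A dx) = ∫ g(x)ρ_A(x) dx`. [folklore] -/
theorem integral_gaussLaw_real (hδ : 0 < δ) (hA : Coercive A δ) (g : (ι → ℝ) → ℝ) :
    ∫ x, g x ∂gaussLaw A = ∫ x, g x * gaussDensity A x := by
  rw [integral_gaussLaw hδ hA]
  refine integral_congr_ae (Eventually.of_forall fun x => ?_)
  dsimp only
  rw [smul_eq_mul, mul_comm]

omit [DecidableEq ι] in
/-- Integrability against the law is integrability of `g·ρ_A`. [folklore] -/
theorem integrable_gaussLaw_iff (hδ : 0 < δ) (hA : Coercive A δ) (g : (ι → ℝ) → ℝ) :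
    Integrable g (gaussLaw A) ↔ Integrable fun x => g x * gaussDensity A x := by
  unfold gaussLaw
  rw [integrable_withDensity_iff_integrable_smul (measurable_toNNReal_gaussDensity A)]
  have e : (fun x : ι → ℝ => (gaussDensity A x).toNNReal • g x) = fun x => g x * gaussDensity A x := by
    funext x
    have h0 : 0 ≤ gaussDensity A x := gaussDensity_nonneg hδ hA x
    rw [NNReal.smul_def, Real.coe_toNNReal _ h0, smul_eq_mul, mul_comm]
  rw [e]

omit [DecidableEq ι] in
/-- `ρ_A dx` is a probability measure (`∫ρ_A = 1`). [cite: King1986, (2.15) p.653] -/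
theorem isProbabilityMeasure_gaussLaw (hδ : 0 < δ) (hA : Coercive A δ) : IsProbabilityMeasure (gaussLaw A) := by
  refine ⟨?_⟩
  unfold gaussLaw
  rw [withDensity_apply _ MeasurableSet.univ, Measure.restrict_univ, lintegral_coe_eq_integral]
  · have e : (fun x : ι → ℝ => ((gaussDensity A x).toNNReal : ℝ)) = gaussDensity A :=
      funext fun x => Real.coe_toNNReal _ (gaussDensity_nonneg hδ hA x)
    rw [e, integral_gaussDensity_eq_one hδ hA, ENNReal.ofReal_one]
  · have e : (fun x : ι → ℝ => ((gaussDensity A x).toNNReal : ℝ)) = gaussDensity A :=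
      funext fun x => Real.coe_toNNReal _ (gaussDensity_nonneg hδ hA x)
    rw [e]
    exact integrable_gaussDensity hδ hA

end Law

/-! ## §2 The law of a linear functional `⟨J,·⟩` under `ρ_A dx` is `𝒩(0, ⟨J,A⁻¹J⟩)` -/

section Functional

variable {A : Matrix ι ι ℝ} {δ : ℝ}

/-- `⟨J, A⁻¹J⟩ ≥ 0` (it is a second moment, part Ϝ-s). [folklore] -/
theorem dot_inv_mulVec_nonneg (hδ : 0 < δ) (hA : Coercive A δ) (hsymm : Aᵀ = A) (J : ι → ℝ) : 0 ≤ J ⬝ᵥ (A⁻¹ *ᵥ J) := by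
  rw [← integral_dot_sq_gaussDensity hδ hA hsymm J]
  exact integral_nonneg fun x => mul_nonneg (sq_nonneg _) (gaussDensity_nonneg hδ hA x)

/-- The MGF of `⟨J,·⟩` under `ρ_A dx` is that of `gaussianReal 0 ⟨J,A⁻¹J⟩` (part Τ-a's tilt identity). [cite: King1986, (2.6) p.652] -/
theorem mgf_dot_gaussLaw (hδ : 0 < δ) (hA : Coercive A δ) (hsymm : Aᵀ = A) (J : ι → ℝ) :
    mgf (fun x : ι → ℝ => J ⬝ᵥ x) (gaussLaw A) = mgf id (gaussianReal 0 (J ⬝ᵥ (A⁻¹ *ᵥ J)).toNNReal) := by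
  rw [mgf_id_gaussianReal]
  funext t
  rw [Real.coe_toNNReal _ (dot_inv_mulVec_nonneg hδ hA hsymm J)]
  simp only [mgf]
  rw [integral_gaussLaw_real hδ hA]
  have h := momentLine_zero_eq hδ hA hsymm J t
  simp only [pow_zero, one_mul] at h
  rw [h]
  congr 1
  ring

omit [DecidableEq ι] in
/-- All exponential tilts are integrable: `integrableExpSet ⟨J,·⟩ (ρ_A dx) = ℝ`. [folklore] -/
theorem integrableExpSet_dot_gaussLaw (hδ : 0 < δ) (hA : Coercive A δ) (J : ι → ℝ) :
    integrableExpSet (fun x : ι → ℝ => J ⬝ᵥ x) (gaussLaw A) = Set.univ := by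
  ext t
  simp only [integrableExpSet, Set.mem_setOf_eq, Set.mem_univ, iff_true]
  rw [integrable_gaussLaw_iff hδ hA]
  have h := integrable_pow_mul_exp_mul_gaussDensity hδ hA J 0 t
  simpa only [pow_zero, one_mul] using h

/-- The complex MGFs agree on all of `ℂ` (analytic continuation, Mathlib's `eqOn_complexMGF_of_mgf`). [folklore] -/
theorem complexMGF_dot_gaussLaw (hδ : 0 < δ) (hA : Coercive A δ) (hsymm : Aᵀ = A) (J : ι → ℝ) :
    complexMGF (fun x : ι → ℝ => J ⬝ᵥ x) (gaussLaw A) = complexMGF id (gaussianReal 0 (J ⬝ᵥ (A⁻¹ *ᵥ J)).toNNReal) := by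
  haveI := isProbabilityMeasure_gaussLaw hδ hA
  funext z
  have h := eqOn_complexMGF_of_mgf (mgf_dot_gaussLaw hδ hA hsymm J)
  refine h ?_
  show z.re ∈ interior (integrableExpSet (fun x : ι → ℝ => J ⬝ᵥ x) (gaussLaw A))
  rw [integrableExpSet_dot_gaussLaw hδ hA J, interior_univ]
  exact Set.mem_univ _

omit [DecidableEq ι] in
/-- `x ↦ ⟨J,x⟩` is measurable. [folklore] -/
theorem measurable_dot (J : ι → ℝ) : Measurable fun x : ι → ℝ => J ⬝ᵥ x := by
  have h : Continuous fun x : ι → ℝ => J ⬝ᵥ x := by simp only [dotProduct]; fun_prop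
  exact h.measurable

/-- ★★★ **THE LAW OF `⟨J,·⟩` UNDER `ρ_A dx` IS `𝒩(0, ⟨J,A⁻¹J⟩)`** (complex MGFs separate laws, `Measure.ext_of_complexMGF_eq`).
[cite: King1986, (2.6) p.652, Thm 2.1 (2.23) p.654] -/
theorem map_dot_gaussLaw (hδ : 0 < δ) (hA : Coercive A δ) (hsymm : Aᵀ = A) (J : ι → ℝ) :
    (gaussLaw A).map (fun x : ι → ℝ => J ⬝ᵥ x) = gaussianReal 0 (J ⬝ᵥ (A⁻¹ *ᵥ J)).toNNReal := by
  haveI := isProbabilityMeasure_gaussLaw hδ hA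
  have h := Measure.ext_of_complexMGF_eq (measurable_dot J).aemeasurable aemeasurable_id (complexMGF_dot_gaussLaw hδ hA hsymm J)
  rwa [Measure.map_id] at h

end Functional

/-! ## §3 `ρ_A dx` is Gaussian and is the Gaussian field of kernel `A⁻¹` -/

section Identification

variable {A : Matrix ι ι ℝ} {δ : ℝ}

/-- Every continuous linear functional on `ℝ^ι` is `⟨J_L, ·⟩` with `J_L(i) = L(e_i)`. [folklore] -/
theorem dual_apply_eq_dot (L : (ι → ℝ) →L[ℝ] ℝ) (x : ι → ℝ) :
    L x = (fun i => L (fun j => if i = j then (1 : ℝ) else 0)) ⬝ᵥ x := by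
  rw [show L x = (L : (ι → ℝ) →ₗ[ℝ] ℝ) x from rfl, LinearMap.pi_apply_eq_sum_univ]
  simp only [dotProduct, smul_eq_mul, ContinuousLinearMap.coe_coe]
  exact Finset.sum_congr rfl fun i _ => mul_comm _ _

/-- ★★★ **`ρ_A dx` IS A GAUSSIAN MEASURE** on the Banach space `ℝ^ι` (Mathlib's `ProbabilityTheory.IsGaussian`). [cite: King1986, (2.6) p.652] -/
theorem isGaussian_gaussLaw (hδ : 0 < δ) (hA : Coercive A δ) (hsymm : Aᵀ = A) : IsGaussian (gaussLaw A) := by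
  refine isGaussian_of_map_eq_gaussianReal fun L => ?_
  set J : ι → ℝ := fun i => L (fun j => if i = j then (1 : ℝ) else 0)
  have hL : (L : (ι → ℝ) → ℝ) = fun x => J ⬝ᵥ x := funext fun x => dual_apply_eq_dot L x
  refine ⟨0, (J ⬝ᵥ (A⁻¹ *ᵥ J)).toNNReal, ?_⟩
  rw [hL]
  exact map_dot_gaussLaw hδ hA hsymm J

/-- The coordinates are centred under `ρ_A dx`. [folklore] -/
theorem integral_eval_gaussLaw (hδ : 0 < δ) (hA : Coercive A δ) (hsymm : Aᵀ = A) (s : ι) : ∫ ω, ω s ∂gaussLaw A = 0 := by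
  rw [integral_gaussLaw_real hδ hA]
  exact integral_eval_gaussDensity hδ hA hsymm s

/-- The covariance of the coordinates under `ρ_A dx` is `A⁻¹` (part Ϝ-s). [cite: King1986, (2.6) p.652, (2.23) p.654] -/
theorem covariance_eval_gaussLaw (hδ : 0 < δ) (hA : Coercive A δ) (hsymm : Aᵀ = A) (s t : ι) :
    cov[fun ω : ι → ℝ => ω s, fun ω : ι → ℝ => ω t; gaussLaw A] = A⁻¹ s t := by
  rw [ProbabilityTheory.covariance]
  have hs := integral_eval_gaussLaw hδ hA hsymm s
  have ht := integral_eval_gaussLaw hδ hA hsymm t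
  simp only [hs, ht, sub_zero]
  rw [integral_gaussLaw_real hδ hA]
  exact integral_eval_mul_gaussDensity hδ hA hsymm s t

/-- The coordinate process is a Gaussian process under `ρ_A dx` (restrictions are continuous linear images of a Gaussian measure). [folklore] -/
theorem isGaussianProcess_eval_gaussLaw (hδ : 0 < δ) (hA : Coercive A δ) (hsymm : Aᵀ = A) :
    IsGaussianProcess (fun (s : ι) (ω : ι → ℝ) => ω s) (gaussLaw A) := by
  haveI := isGaussian_gaussLaw hδ hA hsymm
  refine ⟨fun I => ⟨?_⟩⟩
  have e : (fun ω : ι → ℝ => I.restrict fun s => ω s)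
      = ⇑(ContinuousLinearMap.pi fun i : I => ContinuousLinearMap.proj (R := ℝ) (φ := fun _ : ι => ℝ) (i : ι)) := by
    funext ω
    rfl
  rw [e]
  infer_instance

/-- `A⁻¹` is a positive semidefinite kernel (symmetric; its form is a second moment). [folklore] -/
theorem isPosSemidefKernel_inv (hδ : 0 < δ) (hA : Coercive A δ) (hsymm : Aᵀ = A) : IsPosSemidefKernel fun i j : ι => A⁻¹ i j := by
  have hpsd : (A⁻¹).PosSemidef := by
    refine Matrix.PosSemidef.of_dotProduct_mulVec_nonneg ?_ fun x => ?_
    · show (A⁻¹)ᴴ = A⁻¹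
      rw [Matrix.conjTranspose_eq_transpose_of_trivial]
      exact transpose_inv_of_transpose_eq hsymm
    · rw [star_trivial]
      exact dot_inv_mulVec_nonneg hδ hA hsymm x
  intro I
  exact hpsd.submatrix _

/-- ★★★ **IDENTIFICATION: `ρ_A dx = gaussianFieldOfKernel (A⁻¹)`** — the density-defined law of parts Τ∕Ϡ∕Ϝ is the tree's Kolmogorov-built Gaussian
field with covariance kernel `A⁻¹` (uniqueness of centred Gaussian laws with given covariance, Kallenberg Lemma 13.1). [cite: King1986, (2.6) p.652] -/
theorem gaussLaw_eq_gaussianFieldOfKernel (hδ : 0 < δ) (hA : Coercive A δ) (hsymm : Aᵀ = A) :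
    gaussLaw A = gaussianFieldOfKernel fun i j : ι => A⁻¹ i j := by
  haveI := isProbabilityMeasure_gaussLaw hδ hA
  exact eq_gaussianFieldOfKernel_of_isGaussianProcess (isPosSemidefKernel_inv hδ hA hsymm) (isGaussianProcess_eval_gaussLaw hδ hA hsymm)
    (integral_eval_gaussLaw hδ hA hsymm) (covariance_eval_gaussLaw hδ hA hsymm)

end Identification

end Summit.QuantumFields.YangMills.BalabanUVNodes.N15KingModelRung.FreeField

/-! ## §4 KING: the law of the block averages of the fine free field is the Gaussian field of kernel `S₂^{(K)}` -/

namespace Summit.QuantumFields.YangMills.BalabanUVNodes.N15KingModelRung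

open Literature.MathematicalPhysics.QuantumFieldTheory (gaussianFieldOfKernel)
open Literature.MathematicalPhysics.QuantumFieldTheory.Balaban1983to89.B5Prop11Plancherel (Tor)
open Literature.MathematicalPhysics.QuantumFieldTheory.Balaban1983to89.QGQInverse (Coercive isUnit_of_coercive)
open FreeField

section King

variable {d : ℕ} (L : ℕ) (M : Fin (d + 1) → ℕ) [hM : ∀ ν, NeZero (M ν)]

/-- ★★★ **THE LAW OF THE BLOCK AVERAGES OF THE FINE FREE FIELD IS THE GAUSSIAN FIELD OF KERNEL `S₂^{(K)}`**: `ρ_{P_K}dφ = gaussianFieldOfKernel S₂^{(K)}`,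
`P_K = (S₂^{(K)})⁻¹` (`A = 0`, `g = 0`). [cite: King1986, (2.6) p.652, (2.13) p.653, Thm 2.1 (2.23) p.654] -/
theorem fineBlockLaw_eq_gaussianFieldOfKernel (N : ℕ) [NeZero N] {m2 : ℝ} (hm : 0 < m2) :
    gaussLaw (fineBlockPrec M N m2) = gaussianFieldOfKernel (kingS2 N M m2) := by
  rw [gaussLaw_eq_gaussianFieldOfKernel hm (coercive_fineBlockPrec M N hm) (fineBlockPrec_transpose M N m2), fineBlockPrec_inv M N hm]
  rfl

/-- ★★★ **THE `K = ∞` TWIN**: `ρ_{P_∞}dφ = gaussianFieldOfKernel S₂^{(∞)}`. [cite: King1986, (2.6) p.652, Thm 2.1 (2.23) p.654] -/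
theorem fineBlockLawLim_eq_gaussianFieldOfKernel (hLodd : Odd L) (hL : 2 ≤ L) {m2 : ℝ} (hm : 0 < m2) :
    gaussLaw (fineBlockPrecLim M m2) = gaussianFieldOfKernel (kingS2Lim M m2) := by
  rw [gaussLaw_eq_gaussianFieldOfKernel hm (coercive_fineBlockPrecLim L M hLodd hL hm) (fineBlockPrecLim_transpose M m2),
    fineBlockPrecLim_inv L M hLodd hL hm]
  rfl

/-- ★★ The block-field law is a Gaussian measure on `ℝ^{𝕋_M}`. [cite: King1986, (2.6) p.652] -/
theorem isGaussian_fineBlockLaw (N : ℕ) [NeZero N] {m2 : ℝ} (hm : 0 < m2) : IsGaussian (gaussLaw (fineBlockPrec M N m2)) :=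
  isGaussian_gaussLaw hm (coercive_fineBlockPrec M N hm) (fineBlockPrec_transpose M N m2)

/-- ★★ The limit block-field law is a Gaussian measure. [cite: King1986, (2.6) p.652] -/
theorem isGaussian_fineBlockLawLim (hLodd : Odd L) (hL : 2 ≤ L) {m2 : ℝ} (hm : 0 < m2) : IsGaussian (gaussLaw (fineBlockPrecLim M m2)) :=
  isGaussian_gaussLaw hm (coercive_fineBlockPrecLim L M hLodd hL hm) (fineBlockPrecLim_transpose M m2)

/-- ★★ **THE SMEARED BLOCK FIELD IS A REAL GAUSSIAN**: `⟨J,φ⟩ ∼ 𝒩(0, ⟨J, S₂^{(K)}J⟩)` under `ρ_{P_K}dφ`. [cite: King1986, (2.13) p.653, Thm 2.1 (2.22)–(2.23) p.654] -/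
theorem map_dot_fineBlockLaw (N : ℕ) [NeZero N] {m2 : ℝ} (hm : 0 < m2) (J : Tor M → ℝ) :
    (gaussLaw (fineBlockPrec M N m2)).map (fun φ : Tor M → ℝ => J ⬝ᵥ φ) = gaussianReal 0 (J ⬝ᵥ (Matrix.of (kingS2 N M m2) *ᵥ J)).toNNReal := by
  rw [map_dot_gaussLaw hm (coercive_fineBlockPrec M N hm) (fineBlockPrec_transpose M N m2), fineBlockPrec_inv M N hm]

/-- `φ(x) ∼ 𝒩(0, S₂^{(K)}(x,x))` under `ρ_{P_K}dφ`. [cite: King1986, (2.13) p.653, Thm 2.1 (2.23) p.654] -/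
theorem map_eval_fineBlockLaw (N : ℕ) [NeZero N] {m2 : ℝ} (hm : 0 < m2) (x : Tor M) :
    (gaussLaw (fineBlockPrec M N m2)).map (fun φ : Tor M → ℝ => φ x) = gaussianReal 0 (kingS2 N M m2 x x).toNNReal := by
  have h := map_dot_fineBlockLaw M N hm (Pi.single x 1)
  simp_rw [single_one_dotProduct, Matrix.mulVec_single_one] at h
  rw [h]
  rfl

end King

end Summit.QuantumFields.YangMills.BalabanUVNodes.N15KingModelRung

end
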